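import Summits.ValiantsHypothesis.ValiantsHypothesis.Theorems.KPlusLogSqLawStaticTridiagonalDefiniteAll
import Summits.ValiantsHypothesis.ValiantsHypothesis.Theorems.KPlusLogSqLawTridiagonalRealStaticSixSeven
import Summits.ValiantsHypothesis.ValiantsHypothesis.Theorems.KPlusLogSqLawTridiagonalRealStaticSevenEight
import Summits.ValiantsHypothesis.ValiantsHypothesis.Theorems.KPlusLogSqLawTridiagonalRealStaticEightTen
import Summits.ValiantsHypothesis.ValiantsHypothesis.Theorems.KPlusLogSqLawTridiagonalRealStaticNineEleven
import Summits.ValiantsHypothesis.ValiantsHypothesis.Theorems.KPlusLogSqLawTridiagonalRealStaticTenThirteen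
import Summits.ValiantsHypothesis.ValiantsHypothesis.Theorems.KPlusLogSqLawTridiagonalRealStaticElevenFourteen
import Summits.ValiantsHypothesis.ValiantsHypothesis.Theorems.KPlusLogSqLawTridiagonalRealStaticTwelveSixteen

/-!
# Route «KPlusLogSqLaw», crux `WeakLifting` (stmt-ValiantsHypothesis-19561) — REAL side of the tridiagonal sector:
# the static definite tridiagonal real row is at least `⌊4m/3⌋ − 2` for EVERY `m ≥ 6` (slope `4/3` in the kernel)

HONEST FRAMING.  Helper (`--supports stmt-ValiantsHypothesis-19561 --as helper`), seat val-sym-lift-p1 (g11), cell `pub-symmetroid`, 2026-08-27,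
in the typed currency of the desk's α target of record `staticTridiagonal_definite_posRoots_le` (lead R2102/R2114: a real symmetric TRIDIAGONAL
matrix of MONOMIALS `c i j · X ^ (e i j)` with POSITIVE diagonal coefficients has at most `B m` distinct positive determinant zeros, `B` explicit
and linear).  LOWER side only: this file GLUES the seat's fixed-size witnesses (`…TridiagonalRealStatic{SixSeven, SevenEight, EightTen, NineEleven, TenThirteen,
ElevenFourteen, TwelveSixteen}`: `7, 8, 10, 11, 13, 14, 16` zeros at `m = 6, …, 12`) by val-sym-lift-p2's block-sum mechanism (`…StaticTridiagonalDefiniteAll`: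
`det_monomialMatrix_rescale`, `comp_C_mul_X_ne_zero`, `card_posRoots_le_comp`; here re-run with the zero COUNT decoupled from the SIZE,
`exists_glue_count`) into an ALL-SIZES statement:
* `exists_static_definite_tridiagonal_fourThirds` — for every `m ≥ 6` there is a static definite symmetric tridiagonal `m × m` monomial matrix
  whose determinant has at least `⌊4m/3⌋ − 2` distinct positive zeros (`m = 12q + s`: `q` copies of the size-`12` sixteen-zero block and one
  block of size `s ∈ {6,…,17}`);
* `fourThirds_le_of_definiteRow` — consequently every admissible law `B` on the sector has `⌊4m/3⌋ − 2 ≤ B m` for all `m ≥ 6`; a linear law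
  `C·m + C₀` needs `C ≥ 4/3` (lift-p2's `le_of_definiteRow`, p554194, gave `C ≥ 1`).
The seat's located/paper LADDER (memo ROTATING-DETECTOR-liftp1g11.md §3b: sizes `7 + 2k` with `≥ 8 + 3k` zeros, slope `3/2`) is NOT claimed here —
its rungs beyond `m = 12` need exponents that grow super-exponentially and are not typed; gluing trades the ladder's `3/2` for a kernel `4/3`.
Nothing here is an UPPER bound; nothing bears on `WeakLifting` / `TropicalB` (stmt-19771) in their windows, on Conjecture B, on the Door-A registers,
on `MatrixDescartes` (stmt-ValiantsHypothesis-18050) or on VP ≠ VNP.  [folklore: block determinants + generic rescaling (val-sym-lift-p2 g8); data of this seat]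
-/

-- `Summit.ValiantsHypothesis.ValiantsHypothesis.…` repeats a component by the D-0017 layout (single-conjunct summit); the name is mandated.
set_option linter.dupNamespace false
set_option autoImplicit false

namespace Summit.ValiantsHypothesis.ValiantsHypothesis.Theorems.KPlusLogSqLaw.StaticTridiagonalRealExcess

open Polynomial Finset
open Summit.ValiantsHypothesis.ValiantsHypothesis.Theorems.KPlusLogSqLaw.TridiagonalSector
  (det_monomialMatrix_rescale comp_C_mul_X_ne_zero card_posRoots_le_comp)

/-- **Gluing with free counts** (val-sym-lift-p2's `exists_glue` with the zero count decoupled from the size): if an `m₁ × m₁` static definite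
tridiagonal monomial matrix has `≥ N₁ ≥ 1` distinct positive determinant zeros and an `m₂ × m₂` one has `≥ N₂ ≥ 1`, then the block sum of the
first with a generic rescaling `X ↦ λX` of the second is an `(m₁ + m₂) × (m₁ + m₂)` static definite tridiagonal monomial matrix with `≥ N₁ + N₂`
distinct positive determinant zeros (`det = det T₁ · (det T₂)(λX)`, root sets disjoint for `λ` off the finite set of root ratios).
[folklore: block determinant + generic rescaling; proof = lift-p2 g8's, verbatim up to the counts] -/
theorem exists_glue_count {m₁ m₂ N₁ N₂ : ℕ}
    (h₁ : ∃ (c : Fin m₁ → Fin m₁ → ℝ) (e : Fin m₁ → Fin m₁ → ℕ), (∀ i j, c i j = c j i) ∧ (∀ i j, e i j = e j i) ∧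
      (∀ i j : Fin m₁, (i : ℕ) + 1 < j ∨ (j : ℕ) + 1 < i → c i j = 0) ∧ (∀ i, 0 < c i i) ∧
      N₁ ≤ ((Matrix.det (Matrix.of fun i j => C (c i j) * (X : ℝ[X]) ^ e i j)).roots.toFinset.filter (fun t : ℝ => 0 < t)).card)
    (h₂ : ∃ (c : Fin m₂ → Fin m₂ → ℝ) (e : Fin m₂ → Fin m₂ → ℕ), (∀ i j, c i j = c j i) ∧ (∀ i j, e i j = e j i) ∧
      (∀ i j : Fin m₂, (i : ℕ) + 1 < j ∨ (j : ℕ) + 1 < i → c i j = 0) ∧ (∀ i, 0 < c i i) ∧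
      N₂ ≤ ((Matrix.det (Matrix.of fun i j => C (c i j) * (X : ℝ[X]) ^ e i j)).roots.toFinset.filter (fun t : ℝ => 0 < t)).card)
    (hN₁ : 0 < N₁) (hN₂ : 0 < N₂) :
    ∃ (c : Fin (m₁ + m₂) → Fin (m₁ + m₂) → ℝ) (e : Fin (m₁ + m₂) → Fin (m₁ + m₂) → ℕ), (∀ i j, c i j = c j i) ∧ (∀ i j, e i j = e j i) ∧
      (∀ i j : Fin (m₁ + m₂), (i : ℕ) + 1 < j ∨ (j : ℕ) + 1 < i → c i j = 0) ∧ (∀ i, 0 < c i i) ∧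
      N₁ + N₂ ≤ ((Matrix.det (Matrix.of fun i j => C (c i j) * (X : ℝ[X]) ^ e i j)).roots.toFinset.filter
        (fun t : ℝ => 0 < t)).card := by
  obtain ⟨c₁, e₁, hc₁, he₁, hb₁, hd₁, hr₁⟩ := h₁
  obtain ⟨c₂, e₂, hc₂, he₂, hb₂, hd₂, hr₂⟩ := h₂
  set P₁ : ℝ[X] := Matrix.det (Matrix.of fun i j => C (c₁ i j) * (X : ℝ[X]) ^ e₁ i j) with hP₁
  set P₂ : ℝ[X] := Matrix.det (Matrix.of fun i j => C (c₂ i j) * (X : ℝ[X]) ^ e₂ i j) with hP₂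
  have hP₁ne : P₁ ≠ 0 := by
    intro h
    rw [h, roots_zero, Multiset.toFinset_zero, Finset.filter_empty, Finset.card_empty] at hr₁
    omega
  have hP₂ne : P₂ ≠ 0 := by
    intro h
    rw [h, roots_zero, Multiset.toFinset_zero, Finset.filter_empty, Finset.card_empty] at hr₂
    omega
  -- a rescaling factor avoiding every ratio of positive roots
  let R₁ := P₁.roots.toFinset.filter (fun t : ℝ => 0 < t)
  let R₂ := P₂.roots.toFinset.filter (fun t : ℝ => 0 < t)
  let bad : Finset ℝ := (R₁ ×ˢ R₂).image (fun rs => rs.2 / rs.1)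
  let la : ℝ := 1 + ∑ b ∈ bad, |b|
  have hla : 0 < la := by positivity
  have hla_not : ∀ r ∈ R₁, ∀ s ∈ R₂, s / r ≠ la := by
    intro r hr s hs h
    have hmem : s / r ∈ bad := Finset.mem_image.mpr ⟨(r, s), Finset.mem_product.mpr ⟨hr, hs⟩, rfl⟩
    have hle : |s / r| ≤ ∑ b ∈ bad, |b| := Finset.single_le_sum (fun b _ => abs_nonneg b) hmem
    have : s / r ≤ |s / r| := le_abs_self _
    linarith
  -- the glued matrix on `Fin m₁ ⊕ Fin m₂ ≃ Fin (m₁ + m₂)`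
  let E : Fin m₁ ⊕ Fin m₂ ≃ Fin (m₁ + m₂) := finSumFinEquiv
  let c : Fin (m₁ + m₂) → Fin (m₁ + m₂) → ℝ := fun i j =>
    Sum.elim (fun a => Sum.elim (fun b => c₁ a b) (fun _ => 0) (E.symm j))
      (fun a => Sum.elim (fun _ => 0) (fun b => c₂ a b * la ^ e₂ a b) (E.symm j)) (E.symm i)
  let e : Fin (m₁ + m₂) → Fin (m₁ + m₂) → ℕ := fun i j =>
    Sum.elim (fun a => Sum.elim (fun b => e₁ a b) (fun _ => 0) (E.symm j))
      (fun a => Sum.elim (fun _ => 0) (fun b => e₂ a b) (E.symm j)) (E.symm i)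
  have hval_inl : ∀ (i : Fin (m₁ + m₂)) (a : Fin m₁), E.symm i = Sum.inl a → (i : ℕ) = a := by
    intro i a h
    have : i = E (Sum.inl a) := by rw [← h, Equiv.apply_symm_apply]
    rw [this]; simp [E]
  have hval_inr : ∀ (i : Fin (m₁ + m₂)) (a : Fin m₂), E.symm i = Sum.inr a → (i : ℕ) = m₁ + a := by
    intro i a h
    have : i = E (Sum.inr a) := by rw [← h, Equiv.apply_symm_apply]
    rw [this]; simp [E]
  refine ⟨c, e, ?_, ?_, ?_, ?_, ?_⟩
  · intro i j
    rcases hi : E.symm i with a | a <;> rcases hj : E.symm j with b | b <;> simp [c, hi, hj, hc₁, hc₂, he₂]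
  · intro i j
    rcases hi : E.symm i with a | a <;> rcases hj : E.symm j with b | b <;> simp [e, hi, hj, he₁, he₂]
  · intro i j hij
    rcases hi : E.symm i with a | a <;> rcases hj : E.symm j with b | b
    · have h1 := hval_inl i a hi
      have h2 := hval_inl j b hj
      simp only [c, hi, hj, Sum.elim_inl]
      exact hb₁ a b (by omega)
    · simp [c, hi, hj]
    · simp [c, hi, hj]
    · have h1 := hval_inr i a hi
      have h2 := hval_inr j b hj
      simp only [c, hi, hj, Sum.elim_inr]
      rw [hb₂ a b (by omega), zero_mul]
  · intro i
    rcases hi : E.symm i with a | a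
    · simp only [c, hi, Sum.elim_inl]; exact hd₁ a
    · simp only [c, hi, Sum.elim_inr]; exact mul_pos (hd₂ a) (pow_pos hla _)
  · -- determinant = det T₁ · (det T₂)(λX); the positive roots are disjoint, the counts add
    let T₁ : Matrix (Fin m₁) (Fin m₁) ℝ[X] := Matrix.of fun a b => C (c₁ a b) * (X : ℝ[X]) ^ e₁ a b
    let D : Matrix (Fin m₂) (Fin m₂) ℝ[X] := Matrix.of fun a b => C (c₂ a b * la ^ e₂ a b) * (X : ℝ[X]) ^ e₂ a b
    have hglue : (Matrix.of fun i j => C (c i j) * (X : ℝ[X]) ^ e i j) = Matrix.reindex E E (Matrix.fromBlocks T₁ 0 0 D) := by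
      ext i j
      rw [Matrix.reindex_apply, Matrix.submatrix_apply, Matrix.of_apply]
      rcases hi : E.symm i with a | a <;> rcases hj : E.symm j with b | b <;>
        simp [c, e, T₁, D, hi, hj, Matrix.fromBlocks_apply₁₁, Matrix.fromBlocks_apply₁₂, Matrix.fromBlocks_apply₂₁,
          Matrix.fromBlocks_apply₂₂]
    have hD : D.det = P₂.comp (C la * X) := det_monomialMatrix_rescale c₂ e₂ la
    have hdet : (Matrix.of fun i j => C (c i j) * (X : ℝ[X]) ^ e i j).det = P₁ * P₂.comp (C la * X) := by
      rw [hglue, Matrix.det_reindex_self, Matrix.det_fromBlocks_zero₂₁, hD]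
    rw [hdet]
    have hQne : P₂.comp (C la * X) ≠ 0 := comp_C_mul_X_ne_zero hP₂ne hla.ne'
    have hprod : P₁ * P₂.comp (C la * X) ≠ 0 := mul_ne_zero hP₁ne hQne
    -- root sets
    have hunion : R₁ ∪ (P₂.comp (C la * X)).roots.toFinset.filter (fun t : ℝ => 0 < t) ⊆
        (P₁ * P₂.comp (C la * X)).roots.toFinset.filter (fun t : ℝ => 0 < t) := by
      intro x hx
      rw [Finset.mem_filter, Multiset.mem_toFinset, mem_roots hprod, IsRoot, eval_mul, mul_eq_zero]
      rcases Finset.mem_union.mp hx with h | h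
      · rw [Finset.mem_filter, Multiset.mem_toFinset, mem_roots hP₁ne] at h
        exact ⟨Or.inl h.1, h.2⟩
      · rw [Finset.mem_filter, Multiset.mem_toFinset, mem_roots hQne] at h
        exact ⟨Or.inr h.1, h.2⟩
    have hdisj : Disjoint R₁ ((P₂.comp (C la * X)).roots.toFinset.filter (fun t : ℝ => 0 < t)) := by
      rw [Finset.disjoint_left]
      intro x hx1 hx2
      rw [Finset.mem_filter, Multiset.mem_toFinset, mem_roots hQne, IsRoot, eval_comp, eval_mul, eval_C, eval_X] at hx2
      have hx1' := hx1
      rw [Finset.mem_filter, Multiset.mem_toFinset, mem_roots hP₁ne] at hx1'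
      have hs : la * x ∈ R₂ := by
        rw [Finset.mem_filter, Multiset.mem_toFinset, mem_roots hP₂ne]
        exact ⟨hx2.1, mul_pos hla hx1'.2⟩
      exact hla_not x hx1 (la * x) hs (by rw [mul_div_assoc, div_self hx1'.2.ne', mul_one])
    calc N₁ + N₂ ≤ R₁.card + ((P₂.comp (C la * X)).roots.toFinset.filter (fun t : ℝ => 0 < t)).card :=
          Nat.add_le_add hr₁ (hr₂.trans (card_posRoots_le_comp hP₂ne hla))
      _ = (R₁ ∪ (P₂.comp (C la * X)).roots.toFinset.filter (fun t : ℝ => 0 < t)).card :=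
          (Finset.card_union_of_disjoint hdisj).symm
      _ ≤ _ := Finset.card_le_card hunion

/-- Monotonicity in the count: a witness with `≥ N` zeros is a witness with `≥ N'` zeros for every `N' ≤ N`. [bookkeeping] -/
theorem exists_witness_mono {m N N' : ℕ} (hN : N' ≤ N)
    (h : ∃ (c : Fin m → Fin m → ℝ) (e : Fin m → Fin m → ℕ), (∀ i j, c i j = c j i) ∧ (∀ i j, e i j = e j i) ∧
      (∀ i j : Fin m, (i : ℕ) + 1 < j ∨ (j : ℕ) + 1 < i → c i j = 0) ∧ (∀ i, 0 < c i i) ∧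
      N ≤ ((Matrix.det (Matrix.of fun i j => C (c i j) * (X : ℝ[X]) ^ e i j)).roots.toFinset.filter (fun t : ℝ => 0 < t)).card) :
    ∃ (c : Fin m → Fin m → ℝ) (e : Fin m → Fin m → ℕ), (∀ i j, c i j = c j i) ∧ (∀ i j, e i j = e j i) ∧
      (∀ i j : Fin m, (i : ℕ) + 1 < j ∨ (j : ℕ) + 1 < i → c i j = 0) ∧ (∀ i, 0 < c i i) ∧
      N' ≤ ((Matrix.det (Matrix.of fun i j => C (c i j) * (X : ℝ[X]) ^ e i j)).roots.toFinset.filter (fun t : ℝ => 0 < t)).card := by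
  obtain ⟨c, e, h1, h2, h3, h4, h5⟩ := h
  exact ⟨c, e, h1, h2, h3, h4, hN.trans h5⟩

/-- **THE STATIC DEFINITE TRIDIAGONAL REAL ROW IS AT LEAST `⌊4m/3⌋ − 2` FOR EVERY `m ≥ 6`** (kernel slope `4/3`).  For every `m ≥ 6` there is
a real symmetric tridiagonal `m × m` matrix of monomials `c i j · X ^ (e i j)` with positive diagonal coefficients whose determinant has at
least `⌊4m/3⌋ − 2` distinct positive zeros: `m = 6, …, 12` are the seat's explicit witnesses (`7, 8, 10, 11, 13 ≥ 11, 14, 16` zeros),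
`m = 13, …, 17` are block sums of two of them (`6+7 ↦ 15`, `7+7 ↦ 16`, `7+8 ↦ 18`, `8+8 ↦ 20`, `8+9 ↦ 21`), and `m ≥ 18` is `12 + (m − 12)`
(the sixteen-zero size-`12` block adds exactly `16 = 4·12/3`). [data of this seat + lift-p2's gluing] -/
theorem exists_static_definite_tridiagonal_fourThirds (m : ℕ) (hm : 6 ≤ m) :
    ∃ (c : Fin m → Fin m → ℝ) (e : Fin m → Fin m → ℕ), (∀ i j, c i j = c j i) ∧ (∀ i j, e i j = e j i) ∧
      (∀ i j : Fin m, (i : ℕ) + 1 < j ∨ (j : ℕ) + 1 < i → c i j = 0) ∧ (∀ i, 0 < c i i) ∧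
      4 * m / 3 - 2 ≤ ((Matrix.det (Matrix.of fun i j => C (c i j) * (X : ℝ[X]) ^ e i j)).roots.toFinset.filter
        (fun t : ℝ => 0 < t)).card := by
  induction m using Nat.strong_induction_on with
  | _ m ih =>
    by_cases h18 : m < 18
    · interval_cases m
      · exact exists_witness_mono (by norm_num) exists_static_definite_tridiagonal_six_seven
      · exact exists_witness_mono (by norm_num) exists_static_definite_tridiagonal_seven_eight
      · exact exists_witness_mono (by norm_num) exists_static_definite_tridiagonal_eight10
      · exact exists_witness_mono (by norm_num) exists_static_definite_tridiagonal_nine_eleven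
      · exact exists_witness_mono (by norm_num) exists_static_definite_tridiagonal_ten13
      · exact exists_witness_mono (by norm_num) exists_static_definite_tridiagonal_eleven14
      · exact exists_witness_mono (by norm_num) exists_static_definite_tridiagonal_twelve16
      · exact exists_witness_mono (by norm_num) (exists_glue_count
          exists_static_definite_tridiagonal_six_seven exists_static_definite_tridiagonal_seven_eight (by norm_num) (by norm_num))
      · exact exists_witness_mono (by norm_num) (exists_glue_count
          exists_static_definite_tridiagonal_seven_eight exists_static_definite_tridiagonal_seven_eight (by norm_num) (by norm_num))
      · exact exists_witness_mono (by norm_num) (exists_glue_count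
          exists_static_definite_tridiagonal_seven_eight exists_static_definite_tridiagonal_eight10 (by norm_num) (by norm_num))
      · exact exists_witness_mono (by norm_num) (exists_glue_count
          exists_static_definite_tridiagonal_eight10 exists_static_definite_tridiagonal_eight10 (by norm_num) (by norm_num))
      · exact exists_witness_mono (by norm_num) (exists_glue_count
          exists_static_definite_tridiagonal_eight10 exists_static_definite_tridiagonal_nine_eleven (by norm_num) (by norm_num))
    · have h6 : 6 ≤ m - 12 := by omega
      have hlt : m - 12 < m := by omega
      have hsum : 12 + (m - 12) = m := by omega
      rw [← hsum]
      exact exists_witness_mono (by omega)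
        (exists_glue_count exists_static_definite_tridiagonal_twelve16 (ih (m - 12) hlt h6) (by norm_num) (by omega))

/-- **Consequently every row bound on the definite static tridiagonal sector has slope at least `4/3`**: if `B : ℕ → ℕ` bounds the number of
distinct positive determinant zeros of every real symmetric tridiagonal matrix of monomials with positive diagonal coefficients, then
`⌊4m/3⌋ − 2 ≤ B m` for all `m ≥ 6`; a linear law `C·m + C₀` needs `C ≥ 4/3` (lift-p2's `le_of_definiteRow`: `C ≥ 1`; the seat's paper ladder:
`C ≥ 3/2`, not typed). [corollary] -/
theorem fourThirds_le_of_definiteRow (B : ℕ → ℕ)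
    (hB : ∀ (m : ℕ) (c : Fin m → Fin m → ℝ) (e : Fin m → Fin m → ℕ), (∀ i j, c i j = c j i) → (∀ i j, e i j = e j i) →
        (∀ i j : Fin m, (i : ℕ) + 1 < j ∨ (j : ℕ) + 1 < i → c i j = 0) → (∀ i, 0 < c i i) →
        ((Matrix.det (Matrix.of fun i j => C (c i j) * (X : ℝ[X]) ^ e i j)).roots.toFinset.filter
          (fun t : ℝ => 0 < t)).card ≤ B m)
    (m : ℕ) (hm : 6 ≤ m) : 4 * m / 3 - 2 ≤ B m := by
  obtain ⟨c, e, hc, he, hband, hpos, hcard⟩ := exists_static_definite_tridiagonal_fourThirds m hm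
  exact hcard.trans (hB m c e hc he hband hpos)

/-- In particular NO law of the shape `card ≤ m + C₀` holds on the sector: for every `C₀` the size `m = 3·C₀ + 9` already needs more.
[corollary] -/
theorem not_posRoots_le_size_add_const (C₀ : ℕ) :
    ¬ (∀ (m : ℕ) (c : Fin m → Fin m → ℝ) (e : Fin m → Fin m → ℕ), (∀ i j, c i j = c j i) → (∀ i j, e i j = e j i) →
        (∀ i j : Fin m, (i : ℕ) + 1 < j ∨ (j : ℕ) + 1 < i → c i j = 0) → (∀ i, 0 < c i i) →
        ((Matrix.det (Matrix.of fun i j => C (c i j) * (X : ℝ[X]) ^ e i j)).roots.toFinset.filter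
          (fun t : ℝ => 0 < t)).card ≤ m + C₀) := by
  intro h
  have := fourThirds_le_of_definiteRow (fun m => m + C₀) h (3 * C₀ + 9) (by omega)
  omega

/-! ### Appended (same seat and session): the slope of any real linear law is at least `4/3` -/

/-- **EVERY LINEAR LAW `Z ≤ A·m + A₀` ON THE STATIC DEFINITE TRIDIAGONAL SECTOR HAS `A ≥ 4/3`** (real constants): if real numbers `A, A₀`
bound the number of distinct positive determinant zeros of every real symmetric tridiagonal `m × m` matrix of monomials with positive diagonal
coefficients by `A·m + A₀`, then `4/3 ≤ A` — from `exists_static_definite_tridiagonal_fourThirds` (`⌊4m/3⌋ − 2` zeros at every size `m ≥ 6`)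
and the Archimedean property. [corollary] -/
theorem fourThirds_le_slope (A A₀ : ℝ)
    (hB : ∀ (m : ℕ) (c : Fin m → Fin m → ℝ) (e : Fin m → Fin m → ℕ), (∀ i j, c i j = c j i) → (∀ i j, e i j = e j i) →
        (∀ i j : Fin m, (i : ℕ) + 1 < j ∨ (j : ℕ) + 1 < i → c i j = 0) → (∀ i, 0 < c i i) →
        (((Matrix.det (Matrix.of fun i j => C (c i j) * (X : ℝ[X]) ^ e i j)).roots.toFinset.filter
          (fun t : ℝ => 0 < t)).card : ℝ) ≤ A * m + A₀) :
    4 / 3 ≤ A := by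
  by_contra hC
  push Not at hC
  -- for every m ≥ 6:  4m ≤ 3 (C m + C₀) + 9
  have key : ∀ m : ℕ, 6 ≤ m → (4 : ℝ) * m ≤ 3 * (A * m + A₀) + 9 := by
    intro m hm
    obtain ⟨c, e, hc, he, hband, hpos, hcard⟩ := exists_static_definite_tridiagonal_fourThirds m hm
    have h1 := hB m c e hc he hband hpos
    have h2 : ((4 * m / 3 - 2 : ℕ) : ℝ) ≤ A * m + A₀ := le_trans (by exact_mod_cast hcard) h1
    have h3 : 4 * m ≤ 3 * (4 * m / 3 - 2) + 9 := by omega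
    have h4 : ((4 * m : ℕ) : ℝ) ≤ ((3 * (4 * m / 3 - 2) + 9 : ℕ) : ℝ) := by exact_mod_cast h3
    push_cast at h4
    linarith
  -- choose m large
  have hpos : 0 < 4 - 3 * A := by linarith
  obtain ⟨n, hn⟩ := exists_nat_gt ((3 * A₀ + 9) / (4 - 3 * A))
  have hk := key (n + 6) (by omega)
  have hcast : ((n + 6 : ℕ) : ℝ) = (n : ℝ) + 6 := by push_cast; ring
  rw [hcast] at hk
  have hlt : (3 * A₀ + 9) / (4 - 3 * A) < n := hn
  rw [div_lt_iff₀ hpos] at hlt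
  nlinarith

end Summit.ValiantsHypothesis.ValiantsHypothesis.Theorems.KPlusLogSqLaw.StaticTridiagonalRealExcess
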